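import Summits.HodgeConjecture.HodgeConjecture.Theorems.LimitExtensionHypersurfaceHodgeFourLowDegreeQuadricTopology
import Summits.HodgeConjecture.HodgeConjecture.Theorems.LimitExtensionHypersurfaceHodgeFourLowDegreeQuadricRulings
import Summits.HodgeConjecture.HodgeConjecture.Theorems.LimitExtensionHypersurfaceHodgeFourLowDegreeHyperplane
import Literature.AlgebraicGeometry.HodgeTheory.HolomorphicBundleChernCharacterProjectiveSpace
import Literature.AlgebraicGeometry.HodgeTheory.HypersurfaceLefschetzUpper
import Literature.AlgebraicGeometry.HodgeTheory.QuarticQuinticFourfoldHodgeClassesAlgebraic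

/-!
# Route LimitExtension — `HypersurfaceHodgeFourLowDegree` (item stmt-HodgeConjecture-3003), VI:
# the Hodge conjecture for smooth quadrics (every dimension), and the degree-`≤ 2` slice of the item

Helper file for the support item `HypersurfaceHodgeFourLowDegree` of route
`HodgeConjecture/LimitExtension` (`∀ d ≤ 5, ∀ X, IsSmoothHypersurface 4 d X → HodgeConjectureFor 4 X`).
With `…Hyperplane` (degree `1`), the topological core `…QuadricTopology` and the algebraic /
scheme-theoretic glue `…QuadricRulings` it PROVES the degree-`2` case UNCONDITIONALLY, in every
dimension:

* `algebraicClasses_eq_top_of_isSmoothHypersurface_two_middle` — on a smooth quadric `X ⊂ ℙ^{2k+1}_ℂ`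
  of dimension `2k`, `algebraicClasses X k = Nᵏ H²ᵏ(X(ℂ); ℂ) = ⊤` (the two rulings: split normal form
  `F = Σᵢ ℓ_{2i} ℓ_{2i+1}` from the tree's `exists_linearSubst_splitForm` and the discharged Jacobian
  criterion; `Λ = X ∩ V₊(odd ℓ's) ≅ ℙᵏ` has codimension `k`; `(X ∖ Λ)(ℂ)` retracts onto the other
  ruling `Λ' ≅ ℙᵏ`, so `H²ᵏ(X)/ker(restriction) ↪ H²ᵏ(ℙᵏ) = ℂ`; the restricted class `hᵏ` is
  algebraic and survives on `Λ'`);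
* `hodgeConjectureFor_of_isSmoothHypersurface_two` — **the Hodge conjecture for every smooth quadric
  hypersurface `X ⊂ ℙⁿ⁺¹_ℂ`, every `n`, every `p`** (middle degree as above; `2p ≠ n` by the
  discharged Lefschetz theorem `Voisin2003_smoothHypersurface_algebraicClasses_eq_top_holds`; Hodge
  model `nonempty_hodgeModel_holds`);
* `limitExtension_hypersurfaceHodgeFourLowDegree_of_le_two`,
  `limitExtension_hypersurfaceHodgeFourLowDegree_of_three_le`,
  `limitExtension_hypersurfaceHodgeFourLowDegree_iff_twoTwo_three_le` — the item's degrees `d ≤ 2`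
  outright, so that `HypersurfaceHodgeFourLowDegree` is EQUIVALENT to its `(2,2)`-slice over the
  degrees `3 ≤ d ≤ 5` (cubic, quartic, quintic), and
  `limitExtension_hypersurfaceHodgeFourLowDegree_of_zucker_conteMurre` — the item CLOSED MODULO the two
  theorems in print `hodgeTwoTwo_algebraic_cubicFourfold` (Zucker 1977) and
  `hodgeTwoTwo_algebraic_quarticQuinticFourfold` (Conte–Murre 1978), Murre's sentence "`HC(·,2)` for
  `V(3)`, `V(4)`, `V(5)` in `ℙ₅`", without Bloch–Srinivas.

No `sorry`, no named fact, no definition.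

## References

* [GriffithsHarrisPrinciples1978] P. Griffiths, J. Harris, Principles of Algebraic Geometry (1978),
  Ch. 6 §1 (linear spaces on quadrics; `H²ᵏ(Q²ᵏ) = ℤ[Λ] ⊕ ℤ[Λ']`).
* [Hartshorne1977] R. Hartshorne, Algebraic Geometry (1977), I Ex. 5.8 (Jacobian criterion), I
  Ex. 2.11, II Ex. 3.20.
* [VoisinHodgeII2003] C. Voisin, Hodge Theory and Complex Algebraic Geometry II (CUP 2003), §1.2.3
  Cor. 1.24–1.25, Rem. 1.26.
* [HatcherAT2002] A. Hatcher, Algebraic Topology (CUP 2002), Thm. 3.19, §3.3.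
-/

-- `Summit.HodgeConjecture.HodgeConjecture.Theorems` is the mandated namespace (single-problem summit:
-- Problem = Summit), which `linter.dupNamespace` flags on every declaration; the lakefile turns the
-- linter off tree-wide (weak option), restated here so stand-alone elaboration is warning-free too.
set_option linter.dupNamespace false

noncomputable section

namespace Summit.HodgeConjecture.HodgeConjecture.Theorems

open scoped LinearAlgebra.Projectivization
open CategoryTheory CategoryTheory.Limits Topology
open Literature.AlgebraicTopology.SingularHomology
open Literature.AlgebraicGeometry.HodgeTheory
open Summit.HodgeConjecture.HodgeConjecture.Theses.LimitExtension

/-! ### Assembly: every middle-degree class on a smooth even-dimensional quadric is algebraic -/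

section Assembly

open AlgebraicGeometry MvPolynomial Literature.AlgebraicGeometry.Motives
  Literature.AlgebraicGeometry.Motives.ProjectiveSpaceCells
open Literature.NumberTheory.Transcendental (projPoint isHomeomorph_projPoint projPoint_injective)

/-- **Every class of `H²ᵏ(X(ℂ); ℂ)` on a smooth `2k`-dimensional quadric `X ⊂ ℙ^{2k+1}_ℂ` is
algebraic: `algebraicClasses X k = Nᵏ H²ᵏ(X(ℂ); ℂ) = ⊤`.** Proof (the two rulings): in the split
normal form `F = Σᵢ ℓ_{2i} ℓ_{2i+1}` (`exists_linearSubst_splitForm`, the Jacobian criterion holding by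
`isNonsingularSystem_of_isHypersurfaceCutOutBy`) let `Λ = X ∩ V₊(ℓ₁, ℓ₃, …, ℓ_{2k+1}) ≅ ℙᵏ` (one
ruling) and `Λ' = V₊(ℓ₀, ℓ₂, …, ℓ_{2k}) ≅ ℙᵏ` (the other). The kernel `K` of the restriction
`H²ᵏ(X(ℂ)) → H²ᵏ((X ∖ Λ)(ℂ))` consists of classes supported on `Λ`, of codimension `k`
(`le_coheight_of_mem_zeroLocus_rulingForms`), so `K ⊆ Nᵏ` by DEFINITION of `supportedClasses`;
`(X ∖ Λ)(ℂ) ≅ {F = 0, T ≠ 0}` (`exists_homeomorph_complexPointsCompl_quadricCompl`) retracts onto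
`Λ'(ℂ) ≅ ℙ(ℂᵏ⁺¹)` (`exists_injective_map_quadricCompl`, the deformation scaling the even coordinates,
`exists_rulingCoordinates`, `eval_splitForm_of_odd_even`), so `H²ᵏ(X(ℂ))/K` embeds in the LINE
`H²ᵏ(ℙᵏ(ℂ))`; the class `h = ι^* a` restricted from `ℙ^{2k+1}` is algebraic
(`map_projectiveSpace_mem_algebraicClasses`) and NOT in `K`, its image in `H²ᵏ(Λ'(ℂ))` being the
restriction of `a ≠ 0` to a linear subspace whose complement retracts onto `Λ` and has no `H_{2k+2}`
(`injective_map_of_eq_projPoint_linSect`). Hence `H²ᵏ(X(ℂ)) = K + ℂ h ⊆ Nᵏ`. Classically: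
`H²ᵏ(Q²ᵏ, ℤ) = ℤ[Λ] ⊕ ℤ[Λ']` (Griffiths–Harris Ch. 6 §1; Hodge's original verification for quadrics).
[cite: GriffithsHarrisPrinciples1978, Ch. 6 §1] [cite: VoisinHodgeII2003, §1.2.3 Cor. 1.24 and Rem. 1.26] -/
theorem algebraicClasses_eq_top_of_isSmoothHypersurface_two_middle {k : ℕ} {X : SchemeOver ℂ}
    (hX : IsSmoothHypersurface (2 * k) 2 X) : algebraicClasses X k = ⊤ := by
  classical
  letI := MvPolynomial.gradedAlgebra (σ := Fin (2 * k + 1 + 1)) (R := ℂ)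
  obtain ⟨F, hFhom, hFirr, hcut⟩ := hX.2
  obtain ⟨-, ι, hι, hrange⟩ := id hcut
  haveI := hι
  -- (1) the split normal form `F = Σᵢ ℓ_{2i} ℓ_{2i+1}` and the ruling coordinates
  have hJ := isNonsingularSystem_of_isHypersurfaceCutOutBy hX.1 hFhom hFirr hcut
  obtain ⟨τ, τ', hτ, hτ', hinv, hinv', hτli, hsplit⟩ := exists_linearSubst_splitForm two_ne_zero hFhom hJ
  obtain ⟨Φ, Ψ, hΦ, hΨ, hΦΨ, hΨΦ⟩ := exists_linearMap_of_linearSubst τ τ' hτ hτ' hinv hinv'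
  obtain ⟨T, S, Lv, S₂, hT, hLv, hTS, hLS₂, hcompat, hblend⟩ := exists_rulingCoordinates Φ Ψ hΦΨ hΨΦ
  -- (2) the ruling `Λ = X ∩ V₊(odd forms)`, closed of codimension `≥ k`
  let Lodd : Fin (k + 1) → MvPolynomial (Fin (2 * k + 1 + 1)) ℂ := fun j ↦ τ ⟨2 * j + 1, by omega⟩
  have hLodd_hom : ∀ j, (Lodd j).IsHomogeneous 1 := fun j ↦ hτ _
  have hLodd_li : LinearIndependent ℂ Lodd :=
    hτli.comp (fun j : Fin (k + 1) ↦ (⟨2 * j + 1, by omega⟩ : Fin (2 * k + 1 + 1))) fun a b h ↦ by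
      have h' := congrArg Fin.val h
      exact Fin.ext (by simp only at h'; omega)
  set Z : Set X.left := ι.left.base ⁻¹' ProjectiveSpectrum.zeroLocus
    (MvPolynomial.homogeneousSubmodule (Fin (2 * k + 1 + 1)) ℂ) (Set.range Lodd) with hZdef
  have hZc : IsClosed Z := (ProjectiveSpectrum.isClosed_zeroLocus _ _).preimage ι.left.continuous
  have hZcodim : ∀ z ∈ Z, ((k : ℕ) : ℕ∞) ≤ Order.coheight z := fun z hz ↦
    le_coheight_of_mem_zeroLocus_rulingForms hX.1 ι Lodd hLodd_li hLodd_hom hz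
  have hT' : ∀ v j, T v j = eval v (Lodd j) := fun v j ↦ by rw [hT, hΦ]
  -- (3) `(X ∖ Λ)(ℂ) ≃ U = {F = 0, T ≠ 0}`
  obtain ⟨Θ, hΘ⟩ := exists_homeomorph_complexPointsCompl_quadricCompl ι hFhom hrange Lodd hLodd_hom
    (T : (Fin (2 * k + 1 + 1) → ℂ) →ₗ[ℂ] (Fin (k + 1) → ℂ)) hT'
  -- (4) the quadric `q = F(·)` is homogeneous of degree `2` and scales under the deformation
  have hq2 : ∀ (c : ℂ) (v : Fin (2 * k + 1 + 1) → ℂ), eval (c • v) F = c ^ 2 * eval v F := fun c v ↦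
    Projectivization.eval_smul_of_isHomogeneous hFhom c v
  have hqΦ : ∀ v, eval v F = eval (Φ v) (splitForm ℂ (2 * k + 1)) := fun v ↦ by
    conv_lhs => rw [← hsplit]
    rw [show Φ v = fun j ↦ eval v (τ j) from funext (hΦ v), MvPolynomial.aeval_eq_bind₁]
    exact MvPolynomial.eval₂Hom_bind₁ _ _ _ _
  have hqb : ∀ (t : ℝ) (v : Fin (2 * k + 1 + 1) → ℂ),
      eval (blend (T : (Fin (2 * k + 1 + 1) → ℂ) →ₗ[ℂ] (Fin (k + 1) → ℂ))
        (S : (Fin (k + 1) → ℂ) →ₗ[ℂ] (Fin (2 * k + 1 + 1) → ℂ)) t v) F = (t : ℂ) * eval v F := fun t v ↦ by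
    rw [hqΦ, hqΦ v]
    exact eval_splitForm_of_odd_even (t : ℂ) (Φ v) _ (hblend t v)
  -- (5) the other ruling `Λ' = [S(ℂᵏ⁺¹)] ⊆ U` is injective on the cohomology of `U`
  obtain ⟨e, he, heinj⟩ := exists_injective_map_quadricCompl T S (fun v ↦ eval v F) hTS hq2 hqb
  -- (6) `r' : H²ᵏ(X(ℂ)) → H²ᵏ(ℙ(ℂᵏ⁺¹))`, restriction followed by `Θ` and `e`; `ker r' ⊆ Nᵏ`
  let ψ : C(ℙ ℂ (Fin (k + 1) → ℂ), ComplexPoints X) :=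
    ⟨fun w ↦ (Θ.symm (e w)).1, continuous_subtype_val.comp (Θ.symm.continuous.comp e.continuous)⟩
  have hfac : ψ = (⟨Subtype.val, continuous_subtype_val⟩ : C(complexPointsCompl X Z, ComplexPoints X)).comp
      ((Θ.symm : C(_, complexPointsCompl X Z)).comp e) := rfl
  have hcomp : ∀ c : complexBetti X (2 * k), singularCohomology.map ℂ ℂ ψ (2 * k) c =
      singularCohomology.map ℂ ℂ e (2 * k) (singularCohomology.map ℂ ℂ (Θ.symm : C(_, complexPointsCompl X Z))
        (2 * k) (complexBetti.restrictCompl X Z (2 * k) c)) := fun c ↦ by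
    rw [hfac, singularCohomology.map_comp, singularCohomology.map_comp]; rfl
  have hK : ∀ c : complexBetti X (2 * k), singularCohomology.map ℂ ℂ ψ (2 * k) c = 0 →
      c ∈ algebraicClasses X k := fun c hc ↦ by
    refine mem_supportedClasses_of_restrictCompl_eq_zero hZc hZcodim ?_
    have h1 : singularCohomology.map ℂ ℂ (Θ.symm : C(_, complexPointsCompl X Z)) (2 * k)
        (complexBetti.restrictCompl X Z (2 * k) c) = 0 :=
      heinj ℂ (2 * k) (by rw [← hcomp, hc, map_zero])
    exact (singularCohomology_map_bijective_of_homeomorph Θ.symm (2 * k)).1 (by rw [h1, map_zero])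
  -- (7) the restricted class `h = ι^* a`, `a ≠ 0` in the line `H²ᵏ(ℙ^{2k+1}(ℂ); ℂ)`, is algebraic …
  have hfr := finrank_complexBetti_projectiveSpace_two_mul_eq_one (2 * k + 1) (p := k) (by omega)
  haveI := Module.finite_of_finrank_eq_succ hfr
  obtain ⟨a, ha⟩ : ∃ a : complexBetti (projectiveSpace (2 * k + 1) ℂ) (2 * k), a ≠ 0 :=
    Module.finrank_pos_iff_exists_ne_zero.1 (by rw [hfr]; exact one_pos)
  have hh_alg : complexBetti.map ι (2 * k) a ∈ algebraicClasses X k :=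
    map_projectiveSpace_mem_algebraicClasses hX.1 ι k a
  -- (8) … and `r' h ≠ 0`: `ι(ℂ) ∘ ψ` is the linear subspace `Λ'`, on which `a` restricts injectively
  have hψι : ∀ w, (AlgPoints.mapContinuous (L := ℂ) ι).comp ψ w = projPoint (2 * k + 1) (linSect T S hTS w).1 :=
    fun w ↦ by
      show AlgPoints.map ι (Θ.symm (e w)).1 = _
      rw [← projPoint_hypersurfacePoint ι, ← hΘ, Homeomorph.apply_symm_apply, he]
  have hrh : singularCohomology.map ℂ ℂ ψ (2 * k) (complexBetti.map ι (2 * k) a) ≠ 0 := by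
    change singularCohomology.map ℂ ℂ ψ (2 * k)
      (singularCohomology.map ℂ ℂ (AlgPoints.mapContinuous (L := ℂ) ι) (2 * k) a) ≠ 0
    rw [← ModuleCat.comp_apply, ← singularCohomology.map_comp]
    have hinj := injective_map_of_eq_projPoint_linSect T S Lv S₂ hTS hLS₂ hcompat
      ((AlgPoints.mapContinuous (L := ℂ) ι).comp ψ) hψι (k := 2 * k) (j := 2 * k + 2) (by omega) (by omega)
    intro h0
    exact ha (hinj (by rw [h0, map_zero]))
  -- (9) `H²ᵏ(ℙ(ℂᵏ⁺¹); ℂ)` is a line, so `r' c` is a multiple of `r' h` for every `c`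
  have hline : ∀ x : singularCohomology ℂ ℂ (ℙ ℂ (Fin (k + 1) → ℂ)) (2 * k),
      ∃ μ : ℂ, μ • singularCohomology.map ℂ ℂ ψ (2 * k) (complexBetti.map ι (2 * k) a) = x := by
    have h1 : Module.finrank ℂ (singularCohomology ℂ ℂ (ℙ ℂ (Fin (k + 1) → ℂ)) (2 * k)) = 1 :=
      ((singularCohomology.mapIso ℂ ℂ ((isHomeomorph_projPoint k).homeomorph (projPoint k))
        (2 * k)).toLinearEquiv.finrank_eq.symm).trans
        (finrank_complexBetti_projectiveSpace_two_mul_eq_one k (p := k) le_rfl)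
    exact (finrank_eq_one_iff_of_nonzero' _ hrh).1 h1
  -- (10) conclusion: `c = (c − μ h) + μ h ∈ K + ℂ h ⊆ Nᵏ`
  refine eq_top_iff.2 fun c _ ↦ ?_
  obtain ⟨μ, hμ⟩ := hline (singularCohomology.map ℂ ℂ ψ (2 * k) c)
  have hdiff : singularCohomology.map ℂ ℂ ψ (2 * k) (c - μ • complexBetti.map ι (2 * k) a) = 0 := by
    rw [map_sub, map_smul, hμ, sub_self]
  have hmem := Submodule.add_mem _ (hK _ hdiff) (Submodule.smul_mem _ μ hh_alg)
  rwa [sub_add_cancel] at hmem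

end Assembly

/-! ### The Hodge conjecture for smooth quadrics, and the item's degrees `d ≤ 2` -/

section Quadrics

open Literature.AlgebraicGeometry.Motives

/-- **The Hodge conjecture for smooth quadrics, unconditionally**: every smooth hypersurface
`X ⊂ ℙⁿ⁺¹_ℂ` of degree `2`, of any dimension `n`, satisfies `HodgeConjectureFor n X` — a Hodge model
exists (`nonempty_hodgeModel_holds`) and for every `p` ALL classes of `H²ᵖ(X(ℂ); ℂ)` are algebraic:
in the middle degree `2p = n` by `algebraicClasses_eq_top_of_isSmoothHypersurface_two_middle` (the
two rulings), off it by the discharged Lefschetz theorem for smooth hypersurfaces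
(`Voisin2003_smoothHypersurface_algebraicClasses_eq_top_holds`). Hodge's own verification of his
conjecture for quadrics. [cite: GriffithsHarrisPrinciples1978, Ch. 6 §1]
[cite: VoisinHodgeII2003, Cor. 1.24 and Cor. 1.25] [cite: Deligne2000, §1] -/
theorem hodgeConjectureFor_of_isSmoothHypersurface_two {n : ℕ} {X : SchemeOver ℂ}
    (hX : IsSmoothHypersurface n 2 X) : HodgeConjectureFor n X := by
  refine ⟨nonempty_hodgeModel_holds hX.1, fun p c _ _ ↦ ?_⟩
  by_cases hp : 2 * p = n
  · subst hp
    rw [algebraicClasses_eq_top_of_isSmoothHypersurface_two_middle hX]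
    exact Submodule.mem_top
  · exact Voisin2003_smoothHypersurface_algebraicClasses_eq_top_holds.mem_algebraicClasses hX hp c

/-- **Degrees `d ≤ 2` of `HypersurfaceHodgeFourLowDegree` hold unconditionally**: `d ≤ 1`
(vacuous / hyperplane, `limitExtension_hypersurfaceHodgeFourLowDegree_of_le_one`) and `d = 2`, the
smooth quadric fourfold (`hodgeConjectureFor_of_isSmoothHypersurface_two`).
[cite: GriffithsHarrisPrinciples1978, Ch. 6 §1] -/
theorem limitExtension_hypersurfaceHodgeFourLowDegree_of_le_two ⦃d : ℕ⦄ ⦃X : SchemeOver ℂ⦄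
    (hd : d ≤ 2) (hX : IsSmoothHypersurface 4 d X) : HodgeConjectureFor 4 X := by
  rcases Nat.lt_or_ge d 2 with h | h
  · exact limitExtension_hypersurfaceHodgeFourLowDegree_of_le_one (by omega) hX
  · obtain rfl : d = 2 := le_antisymm hd h
    exact hodgeConjectureFor_of_isSmoothHypersurface_two hX

/-- **The item from its degrees `3 ≤ d ≤ 5` only** (cubic, quartic, quintic fourfolds: Zucker 1977,
Conte–Murre 1978), degrees `d ≤ 2` being proved outright
(`limitExtension_hypersurfaceHodgeFourLowDegree_of_le_two`). [cite: Zucker1977, (3.2) Theorem, p. 206]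
[cite: ConteMurre1978] -/
theorem limitExtension_hypersurfaceHodgeFourLowDegree_of_three_le
    (h : ∀ ⦃d : ℕ⦄ ⦃X : SchemeOver ℂ⦄, 3 ≤ d → d ≤ 5 → IsSmoothHypersurface 4 d X →
      HodgeConjectureFor 4 X) :
    HypersurfaceHodgeFourLowDegree := by
  unfold HypersurfaceHodgeFourLowDegree
  intro d X hd hX
  rcases Nat.lt_or_ge d 3 with hlt | hle
  · exact limitExtension_hypersurfaceHodgeFourLowDegree_of_le_two (by omega) hX
  · exact h hle hd hX

/-- **The exact residue of the item.** `HypersurfaceHodgeFourLowDegree` (the Hodge conjecture for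
smooth hypersurface fourfolds of degree `≤ 5`) is EQUIVALENT to: for every smooth hypersurface
fourfold `X ⊂ ℙ⁵_ℂ` of degree `3 ≤ d ≤ 5` (cubic, quartic, quintic), every rational `(2,2)`-class of
`H⁴(X(ℂ); ℂ)` lies in `algebraicClasses X 2 = N² H⁴(X(ℂ); ℂ)`. Everything else in the item — Hodge
models, all codimensions `p ≠ 2` (`limitExtension_hypersurfaceHodgeFour_of_twoTwo`), and the degrees
`d ≤ 2` in full — is proved in the tree; the three remaining `(2,2)`-statements are the printed
theorems of Zucker (cubic fourfolds, via normal functions) and Conte–Murre (quartic and quintic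
fourfolds, uniruled), in the tree the named facts
`BlochSrinivas1983_hodgeConjectureDegreeFour_of_chowZeroSupported` (with the proved `CH₀`-support on a
hyperplane section for `d ≤ 4`) and `hodgeTwoTwo_algebraic_quarticQuinticFourfold`, on which the
conditional closing `limitExtension_hypersurfaceHodgeFourLowDegree_of_facts` rests.
[cite: Zucker1977, (3.2) Theorem, p. 206] [cite: ConteMurre1978]
[cite: VoisinHodgeII2003, Prop. 10.26] [cite: Deligne2000, §1] -/
theorem limitExtension_hypersurfaceHodgeFourLowDegree_iff_twoTwo_three_le :
    HypersurfaceHodgeFourLowDegree ↔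
      ∀ ⦃d : ℕ⦄ ⦃X : SchemeOver ℂ⦄, 3 ≤ d → d ≤ 5 → IsSmoothHypersurface 4 d X →
        ∀ c : complexBetti X (2 * 2), IsRationalClass c → IsOfHodgeType 4 X (2 * 2) 2 2 c →
          c ∈ algebraicClasses X 2 :=
  ⟨fun h _ _ _ hd hX c hc hpp ↦ (h hd hX).2 2 c hc hpp,
    fun h22 ↦ limitExtension_hypersurfaceHodgeFourLowDegree_of_three_le fun _ X h3 hd hX ↦
      ⟨nonempty_hodgeModel_holds hX.1, fun p c hc hpp ↦ by
        by_cases hp : p = 2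
        · subst hp
          exact h22 h3 hd hX c hc hpp
        · exact Voisin2003_smoothHypersurface_algebraicClasses_eq_top_holds.mem_algebraicClasses hX
            (by omega) c⟩⟩

/-- **The item from the two theorems in print exactly as Murre states them** ("`HC(·, 2)` is true for
smooth `V(3)`, `V(4)` and `V(5)` in `ℙ₅`": Zucker 1977 for the cubic, Conte–Murre 1978 for the quartic
and quintic fourfold), i.e. CLOSED MODULO the two `B`-free named facts
`hodgeTwoTwo_algebraic_cubicFourfold` and `hodgeTwoTwo_algebraic_quarticQuinticFourfold` — with no
appeal to Bloch–Srinivas' Prop. 10.26: degrees `d ≤ 2` are theorems of the tree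
(`limitExtension_hypersurfaceHodgeFourLowDegree_of_le_two`), degrees `3 ≤ d ≤ 5` are Murre's sentence
(`hodgeTwoTwo_algebraic_hypersurfaceFourfold_of_three_le_of_le_five`).
[cite: MurreTorino1994, Ch. V §5.3.1, Theorem ([CM 1]) and Applications]
[cite: Zucker1977, (3.2) Theorem, p. 206] [cite: ConteMurre1978] -/
theorem limitExtension_hypersurfaceHodgeFourLowDegree_of_zucker_conteMurre
    (hZ : hodgeTwoTwo_algebraic_cubicFourfold) (hCM : hodgeTwoTwo_algebraic_quarticQuinticFourfold) :
    HypersurfaceHodgeFourLowDegree :=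
  limitExtension_hypersurfaceHodgeFourLowDegree_iff_twoTwo_three_le.2 fun _ _ h3 hd hX c hc hpp ↦
    hodgeTwoTwo_algebraic_hypersurfaceFourfold_of_three_le_of_le_five hZ hCM h3 hd hX c hc hpp

end Quadrics

end Summit.HodgeConjecture.HodgeConjecture.Theorems

end
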